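import Literature.AlgebraicGeometry.Resolution.SNCStrataSmooth
import Literature.AlgebraicGeometry.Motives.VarietiesGeometricallyIntegralProofs
import HarnessLib

/-!
# Log resolution of a closed subset of a smooth projective variety, with smooth projective total space

Topic: `Literature/AlgebraicGeometry/Resolution`. The projective refinement of
`exists_logResolution_of_isClosed` (`LogResolutionOfClosedSubset.lean`; Kollár 2007, Thm. 3.21
via Thm. 3.69/3.72, Hironaka's principalization): the composite `Π : W' → W` of Kollár's blow-ups
is projective when `W` is (Hartshorne II 7.16 (c) at each step, `IsBlowup.isProjectiveOver`),
so for a smooth projective variety `X` over an algebraically closed field of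
characteristic zero and a closed `Z ⊊ X` we get a smooth projective `X'` of the same dimension, a
birational `σ : X' → X` which is an isomorphism over `X ∖ Z`, and finitely many ideal sheaves
`D_1, …, D_m` on `X'` all of whose strata `V(Σ_{i ∈ I} D_i)` are smooth over `k` of relative
dimension `dim X - |I|` (`smoothOfRelativeDimension_stratum_of_hasSNC`) with
`σ⁻¹(Z) = ⋃ V(D_i)` (`exists_logResolution_isSmoothProjective`). Everything is proved; no named
facts (D-0026).

## References

* J. Kollár, *Lectures on Resolution of Singularities* (2007), Thm. 3.21 (p. 124), 3.24, Thm. 3.69,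
  3.72. [Kollar2007]
* R. Hartshorne, *Algebraic Geometry*, II Prop. 7.16 (c). [Hartshorne1977]
-/

noncomputable section

open CategoryTheory CategoryTheory.Limits AlgebraicGeometry TopologicalSpace

namespace Literature.AlgebraicGeometry.Resolution

universe u

open Literature.AlgebraicGeometry.Motives

/-! ## Projective log resolution of a closed subset -/

/-- **Log resolution of a closed subset of a regular integral projective variety in
characteristic zero, projective form**: as `exists_logResolution_of_isClosed`, with `W'`
projective over `k` (Kollár 2007, Thm. 3.21: "a birational and projective morphism").
[cite: Kollar2007, Thm. 3.21 (p. 124), Thm. 3.69 (p. 150), 3.72 (p. 152)] -/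
theorem exists_logResolution_isProjectiveOver {k : Type u} [Field k] [CharZero k] {W : Scheme.{u}}
    (s : W ⟶ Spec (.of k)) (hproj : IsProjectiveOver (Over.mk s)) [IsIntegral W]
    (hW : Scheme.IsRegular W) {Z : Set W} (hZ : IsClosed Z) (hZne : Z ≠ Set.univ) :
    ∃ (W' : Scheme.{u}) (f : W' ⟶ W) (E : List W'.IdealSheafData),
      IsIntegral W' ∧ Scheme.IsRegular W' ∧ IsProjectiveOver (Over.mk (f ≫ s)) ∧
      IsIso (f ∣_ ⟨Zᶜ, hZ.isOpen_compl⟩) ∧ HasSNC E ∧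
      f ⁻¹' Z = ⋃ D ∈ E, (D.support : Set W') := by
  haveI : IsProper s := IsProjectiveOver.isProper (X := Over.mk s) hproj
  haveI : IsLocallyNoetherian W := LocallyOfFiniteType.isLocallyNoetherian s
  -- the (radical) ideal of `Z`
  set I : W.IdealSheafData := Scheme.IdealSheafData.vanishingIdeal ⟨Z, hZ⟩ with hIdef
  have hIsupp : (I.support : Set W) = Z := by
    rw [hIdef, Scheme.IdealSheafData.coe_support_vanishingIdeal]; rfl
  have hI : I ≠ ⊥ := by
    intro h0
    apply hZne
    rw [← hIsupp, h0, Scheme.IdealSheafData.support_bot]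
    rfl
  -- order reduction for `(W, 𝓘_Z, ∅, 1)`
  obtain ⟨W', f, M', hres⟩ :=
    Kollar2007MarkedOrderReduction_holds k W s inferInstance inferInstance inferInstance ‹_› hW I hI
      1 le_rfl
  have hmb : IsMultipleBlowup (⟨I, [], 1⟩ : MarkedIdeal W) f M' := hres.1
  -- projectivity along the multiple blow-up (Hartshorne II 7.16 (c) at each step; cf. the
  -- summit-side `isProjectiveOver_of_isMultipleBlowup`, not importable here)
  have hprojW' : ∀ {M₀ : MarkedIdeal W} {W₁ : Scheme.{u}} {g : W₁ ⟶ W} {M₁ : MarkedIdeal W₁},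
      IsMultipleBlowup M₀ g M₁ → IsProjectiveOver (Over.mk (g ≫ s)) := by
    intro M₀ W₁ g M₁ h
    induction h with
    | refl => simpa using hproj
    | @blowup X₁ X₂ σ₁ M₁ h C τ hτ hC hsupp hsnc ih =>
      have := hτ.isProjectiveOver (σ₁ ≫ s) ih
      simpa only [Category.assoc] using this
  refine ⟨W', f, M'.boundary, (hmb.isIntegral_and_ideal_ne_bot hI le_rfl).1, hmb.isRegular hW,
    hprojW' hmb, ?_, hmb.hasSNC_boundary (hasSNC_nil_of_isRegular hW), ?_⟩
  · have hiso := hmb.isIso_morphismRestrict le_rfl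
    have hU : (⟨Zᶜ, hZ.isOpen_compl⟩ : W.Opens) =
        ⟨((⟨I, [], 1⟩ : MarkedIdeal W).ideal.support : Set W)ᶜ,
          (⟨I, [], 1⟩ : MarkedIdeal W).ideal.support.isClosed.isOpen_compl⟩ := by
      ext1
      show Zᶜ = (I.support : Set W)ᶜ
      rw [hIsupp]
    rw [hU]
    exact hiso
  · have key := hmb.preimage_support_union_eq rfl
    have htop : M'.ideal = ⊤ := hres.ideal_eq_top rfl
    simp only [List.not_mem_nil, Set.iUnion_of_empty, Set.iUnion_empty, Set.union_empty, htop,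
      Scheme.IdealSheafData.support_top] at key
    rw [show ((⟨I, [], 1⟩ : MarkedIdeal W).ideal.support : Set W) = Z from hIsupp] at key
    rw [key]
    simp

/-! ## Smooth projective form -/

/-- **Log resolution of a closed subset of a smooth projective variety (algebraically closed
field of characteristic zero)**: for `X` smooth projective geometrically irreducible of dimension
`n` and `Z ⊊ X` closed there are a smooth projective geometrically irreducible `X'` of dimension
`n`, a birational `σ : X' → X` which is an isomorphism over `X ∖ Z`, and ideal sheaves
`D_1, …, D_m` on `X'` (pairwise distinct), every stratum `V(Σ_{i∈I} D_i) → Spec k` being smooth of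
relative dimension `n - |I|`, with `σ⁻¹(Z) = ⋃ᵢ V(D_i)` (Kollár 2007, Thm. 3.21 with 3.24;
strata: `smoothOfRelativeDimension_stratum_of_hasSNC`).
[cite: Kollar2007, Thm. 3.21 (p. 124) and 3.24] -/
theorem exists_logResolution_isSmoothProjective {k : Type u} [Field k] [IsAlgClosed k] [CharZero k]
    {n : ℕ} {X : SchemeOver k} (hX : IsSmoothProjective n X) {Z : Set X.left} (hZ : IsClosed Z)
    (hZne : Z ≠ Set.univ) :
    ∃ (X' : SchemeOver k) (σ : X' ⟶ X) (m : ℕ) (D : Fin m → X'.left.IdealSheafData),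
      IsSmoothProjective n X' ∧ IsBirational σ.left ∧
      IsIso (σ.left ∣_ ⟨Zᶜ, hZ.isOpen_compl⟩) ∧ Function.Injective D ∧
      (∀ I : Finset (Fin m), SmoothOfRelativeDimension (n - I.card) ((⨆ i ∈ I, D i).subschemeι ≫ X'.hom)) ∧
      σ.left ⁻¹' Z = ⋃ i, ((D i).support : Set X'.left) := by
  classical
  haveI := hX.smoothOfRelativeDimension
  haveI : IsIntegral X.left := IsSmoothProjective.isIntegral_holds hX
  have hreg : Scheme.IsRegular X.left := fun x ↦
    isRegularLocalRing_stalk_of_smoothOfRelativeDimension X.hom n x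
  have hproj : IsProjectiveOver (Over.mk X.hom) := isProjectiveOver_mk_hom hX.isProjectiveOver
  obtain ⟨W', f, E, hint, hreg', hproj', hiso, hsnc, hpre⟩ :=
    exists_logResolution_isProjectiveOver X.hom hproj hreg hZ hZne
  haveI := hint
  haveI := hiso
  haveI : IsProper X.hom := hX.isProjectiveOver.isProper
  haveI : IsProper (f ≫ X.hom) := IsProjectiveOver.isProper (X := Over.mk (f ≫ X.hom)) hproj'
  -- the new variety
  let X' : SchemeOver k := Over.mk (f ≫ X.hom)
  let σ : X' ⟶ X := Over.homMk f rfl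
  -- smooth of relative dimension `n`
  haveI : Smooth (f ≫ X.hom) := smooth_of_isRegular_of_perfectField (f ≫ X.hom) hreg'
  obtain ⟨d, hd⟩ := exists_smoothOfRelativeDimension_of_smooth (f ≫ X.hom)
  haveI := hd
  -- birational
  set U : X.left.Opens := ⟨Zᶜ, hZ.isOpen_compl⟩ with hUdef
  have hUne : ((U : X.left.Opens) : Set X.left).Nonempty := by
    rw [hUdef]
    exact Set.nonempty_compl.mpr hZne
  have hU'ne : ((f ⁻¹ᵁ U : W'.Opens) : Set W').Nonempty := by
    obtain ⟨x, hx⟩ := hUne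
    obtain ⟨y, hy⟩ := (Scheme.homeoOfIso (asIso (f ∣_ U))).surjective ⟨x, hx⟩
    exact ⟨y.1, y.2⟩
  have hbir : IsBirational f :=
    ⟨U, U.2.dense hUne, (f ⁻¹ᵁ U).2.dense hU'ne, hiso⟩
  -- `d = n`
  have hdn : d = n := by
    have h1 := topologicalKrullDim_opens_eq X.hom U hUne
    have h2 := topologicalKrullDim_opens_eq (f ≫ X.hom) (f ⁻¹ᵁ U) hU'ne
    have h3 : topologicalKrullDim ((f ⁻¹ᵁ U : W'.Opens) : Scheme.{u}) =
        topologicalKrullDim ((U : X.left.Opens) : Scheme.{u}) :=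
      IsHomeomorph.topologicalKrullDim_eq _ (Scheme.homeoOfIso (asIso (f ∣_ U))).isHomeomorph
    have h4 := topologicalKrullDim_eq_of_smoothOfRelativeDimension (f ≫ X.hom) d
    have h5 := topologicalKrullDim_eq_of_smoothOfRelativeDimension X.hom n
    have : (d : WithBot ℕ∞) = n := h4.symm.trans (h2.symm.trans (h3.trans (h1.trans h5)))
    exact_mod_cast this
  subst hdn
  -- geometrically irreducible
  haveI := geometricallyIntegral_of_isAlgClosed (f ≫ X.hom)
  have hgi : GeometricallyIrreducible (f ≫ X.hom) := inferInstance
  have hX' : IsSmoothProjective d X' := ⟨hd, hproj', hgi⟩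
  -- the boundary divisors, deduplicated
  set L := E.dedup with hL
  let D : Fin L.length → W'.IdealSheafData := fun i ↦ L.get i
  have hDinj : Function.Injective D := List.nodup_iff_injective_get.mp (List.nodup_dedup E)
  have hDmem : ∀ i, D i ∈ E := fun i ↦ List.mem_dedup.mp (List.get_mem L i)
  refine ⟨X', σ, L.length, D, hX', hbir, hiso, hDinj, fun I ↦ ?_, ?_⟩
  · -- the strata
    have hS : ∀ K ∈ I.image D, K ∈ E := by
      intro K hK
      obtain ⟨i, -, rfl⟩ := Finset.mem_image.mp hK
      exact hDmem i
    have hcard : (I.image D).card = I.card := Finset.card_image_of_injective _ hDinj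
    have hsup : (⨆ i ∈ I, D i) = (I.image D).sup id := by
      rw [Finset.sup_image, Function.id_comp, Finset.sup_eq_iSup]
    have key := smoothOfRelativeDimension_stratum_of_hasSNC (n := d) (f ≫ X.hom) hsnc (I.image D) hS
    rw [hcard] at key
    have gen : ∀ J : W'.IdealSheafData, J = (I.image D).sup id →
        SmoothOfRelativeDimension (d - I.card) (J.subschemeι ≫ f ≫ X.hom) := by
      rintro _ rfl; exact key
    exact gen _ hsup
  · -- `σ⁻¹ Z = ⋃ V(D_i)`
    change f ⁻¹' Z = ⋃ i, ((D i).support : Set W')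
    rw [hpre]
    refine Set.ext fun y ↦ ⟨fun hy ↦ ?_, fun hy ↦ ?_⟩
    · obtain ⟨K, hK, hy⟩ := Set.mem_iUnion₂.mp hy
      obtain ⟨i, hi⟩ := List.get_of_mem (List.mem_dedup.mpr hK)
      refine Set.mem_iUnion.mpr ⟨i, ?_⟩
      change y ∈ ((L.get i).support : Set W')
      rwa [hi]
    · obtain ⟨i, hy⟩ := Set.mem_iUnion.mp hy
      exact Set.mem_iUnion₂.mpr ⟨D i, hDmem i, hy⟩

end Literature.AlgebraicGeometry.Resolution
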